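import Literature.Probability.Percolation.IsoradialRectangularCrossingsSSSymmetry
import Literature.Probability.Percolation.QuadCrossingRotationCouplingFiniteQuads
import Literature.Probability.Percolation.QuadCrossingRotationInvarianceOfThm21
import Literature.Probability.Percolation.QuadCrossingNoiseDiscrete
import HarnessLib

/-!
# DKKMO, Theorem 1.2 (`d_SS` half) from Theorem 2.1 (`d_SS` half): the reflection argument of §7.1

Proofs-only companion of `IsoradialRectangularCrossingsSS.lean` (the named fact
`DKKMO2020_thm21_schrammSmirnov`: Duminil-Copin–Kozlowski–Krachun–Manolescu–Oulamara,
*Rotational invariance in critical planar lattice models*, arXiv:2012.11672v1, Theorem 2.1 at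
`q = 1`, Schramm–Smirnov half — universality of the quad-crossing configuration among the
isoradial rectangular lattices `𝕃(α)`) and of `QuadCrossingRotationCoupling.lean` (the named fact
`dkkmo_theorem_1_2_schrammSmirnov`: Theorem 1.2, Schramm–Smirnov half, `q = 1`, `Ω = ℝ²` —
asymptotic rotation invariance of critical bond percolation on `ℤ²` in Schramm–Smirnov's space).
No definition, no named fact.

**Main result.** `dkkmo_theorem_1_2_schrammSmirnov_of_thm21_schrammSmirnov`:
`DKKMO2020_thm21_schrammSmirnov → dkkmo_theorem_1_2_schrammSmirnov`. So the second vendored fact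
is a COROLLARY of the first (the tree already has the loop-side version of this deduction,
`dkkmo_theorem_1_2_of_theorem_1_7`, and the per-quad version,
`dkkmo_crossing_rotation_invariance_of_thm21`).

**The printed proof** (v1 §7.1 p. 42, "Proof of Theorem 1.2, Case of `Ω = ℝ²`"; v2 Remark 1.8):
let `σ_u` be the reflection in the line `e^{iu}ℝ`. "Sample `ω' ∼ φ_{δ𝕃(π/2)}` and couple
`σ_0 ω'` with `ω^α ∼ φ_{δ𝕃(α)}` using Theorem 2.1 (this is doable since
`σ_0 ω' ∼ φ_{δ𝕃(π/2)}`) [...] then couple `σ_{α/2} ω^α` with `ω ∼ φ_{δ𝕃(π/2)}` (doable since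
`σ_{α/2} ω^α ∼ φ_{δ𝕃(α)}`) [...]. Since `d_SS(ω, e^{iα}ω') = d_SS(ω, σ_{α/2}σ_0 ω') =
d_SS(σ_{α/2} ω, σ_0 ω') ≤ d_SS(σ_{α/2}ω, ω^α) + d_SS(ω^α, σ_0 ω')`, the result follows."
Ingredients, all in the tree: `σ_0` is the symmetry `swapSite` of `(𝕃(π/2), φ_{𝕃(π/2)})`
(`isoRectQuadConfig_pi_div_two_image_swapPerm`), `σ_{α/2}` is the symmetry `reflSite` of
`(𝕃(α), φ_{𝕃(α)})` (`isoRectQuadConfig_image_reflPerm` below, `isoRectPercolation_map_reflSite`),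
`e^{iα} = σ_{α/2} ∘ σ_0` (`lineReflection_lineReflection_zero`), and the gluing of two couplings
along a common marginal (`LoopConfig.exists_glued_coupling`, disintegration on the standard
Borel space of bond configurations).

**The one point the printed lines leave implicit.** The chain of (in)equalities uses a metric
`d_SS` that is INVARIANT under the isometries `σ_u`; Schramm–Smirnov only provide metrizability
("the metric, whose definition is implicit", §1.2), and the tree's two facts are accordingly
metric-free (open neighbourhoods of the diagonal of `ℋ_ℂ × ℋ_ℂ`, uniformly in
`α ∈ (ε, π - ε)`). Pulling a neighbourhood back by `σ_{α/2} × σ_{α/2}` produces an `α`-DEPENDENT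
neighbourhood, against which Theorem 2.1 gives no uniform mesh. We do NOT prove joint continuity
of the action of `O(2)` on `ℋ_ℂ`; instead the argument is run on the crossing indicators of
finitely many quads (both facts are equivalent to such statements granted Schramm–Smirnov's
Lemma 5.1, `DKKMO2020_thm21_schrammSmirnov_iff_finiteQuads`,
`dkkmo_theorem_1_2_schrammSmirnov_iff_finiteQuads_of_lemma_5_1`), where the moving quads
`σ_{α/2} Q` are pinned, on a finite net of angles `α₀` (compactness of `[ε, π - ε]`), strictly
between FIXED quads — strict domination `<` is open and `α ↦ σ_{α/2} Q` is continuous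
(`continuous_mapHomeomorph_reflect`), exactly the device of
`exists_forall_abs_sub_le_of_continuity` — so that Theorem 2.1 is only ever applied to two
`α`-independent neighbourhoods built from fixed quads. Passing to an easier quad is free
(configurations are lower sets); the one passage to a harder quad per target quad is paid by
Schramm–Smirnov's continuity estimate (5.1) on the reference lattice `δ𝕃(π/2) = e^{iπ/4}√2 δℤ²`
ONLY (`continuity_isoRectDrawing_pi_div_two`; Lemma 5.1 is discharged in the tree,
`SchrammSmirnov2011_lemma_5_1_holds`), never on `𝕃(α)`.

Contents:
* `reflectHomeomorph_eq_lineReflection` and bookkeeping for `σ_{α/2} = (w ↦ e^{iα} w̄)`;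
* `isoRectQuadConfig_image_reflPerm` — **`S^{α}_{δ}(reflSite ω) = σ_{α/2} · S^{α}_{δ}(ω)`**;
  `prodBernoulli_isoRectCriticalProb_map_image_reflPerm` — `φ_{𝕃(α)}` is `reflSite`-invariant;
* `isoRectQuadConfig_pi_div_two_eq_rotate` — `S^{π/2}_{δ}(ω) = e^{iπ/4} · (ω)_{√2 δ}`, whence
  `measurable_isoRectQuadConfig_pi_div_two`;
* `iff_of_pieces` — the deterministic core (two couplings inside their pieces, the net conditions,
  and the absence of the (5.1)-event force agreement of the crossing indicators);
* `finiteQuads_reflection_of_thm21_schrammSmirnov` — asymptotic invariance of `φ_{δ𝕃(π/2)}`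
  under `σ_{α/2}` on finitely many quads, uniformly in `α ∈ (ε, π - ε)` (v2 §4.1: "(4) implies
  that `φ_{𝕃(π/2)}` is asymptotically invariant under the reflection with respect to
  `e^{iα/2}ℝ`"), from `DKKMO2020_thm21_schrammSmirnov` and (5.1);
* `finiteQuads_rotation_of_thm21_schrammSmirnov` — the same for the rotation `e^{iα}`, on `δℤ²`;
* `dkkmo_theorem_1_2_schrammSmirnov_of_thm21_schrammSmirnov` — the main result.

## References

* [DKKMO2020Rotational] H. Duminil-Copin, K. K. Kozlowski, D. Krachun, I. Manolescu, M. Oulamara,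
  arXiv:2012.11672v1 (2020): Thm. 1.2 p. 5, Thm. 2.1 p. 7, §7.1 p. 42 ("Proof of Theorem 1.2,
  Case of `Ω = ℝ²`"); v2 (2026): Remark 1.8, §4.1.
* [SchrammSmirnov2011] O. Schramm, S. Smirnov, Ann. Probab. 39 (2011), arXiv:1101.5820: §1.3
  (`ℋ_D`, `<`), Lemma 5.1 and eq. (5.1).
* C. Villani, *Optimal transport, old and new*, Grundlehren 338 (2009), Ch. 1 (the gluing lemma);
  R. M. Dudley, *Real analysis and probability* (2002), §11.8.
-/

noncomputable section

open Set Filter Metric Function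
open _root_.MeasureTheory _root_.Topology
open scoped ENNReal Real
open Literature.Probability.LatticeModels Literature.Probability.RandomPlanarGeometry

namespace Literature.Probability.Percolation

open QuadCrossing

/-! ### The reflections `σ_{α/2} : w ↦ e^{iα} w̄` -/

/-- The reflection `w ↦ e^{iα} w̄` written as "conjugate, then rotate by `α`" (the form used in
`QuadCrossingRotationInvarianceOfThm21.lean`) is DKKMO's `σ_{α/2} = lineReflection (α/2)`.
[cite: DKKMO2020Rotational, §7.1 p. 42] -/
theorem reflectHomeomorph_eq_lineReflection (α : ℝ) :
    Complex.conjCLE.toHomeomorph.trans (rotation (Circle.exp α)).toHomeomorph =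
      (lineReflection (α / 2)).toHomeomorph := by
  ext1 z
  rw [Homeomorph.trans_apply, ContinuousLinearEquiv.coe_toHomeomorph, Complex.conjCLE_apply,
    LinearIsometryEquiv.coe_toHomeomorph, LinearIsometryEquiv.coe_toHomeomorph, rotation_apply,
    lineReflection_apply, show 2 * (α / 2) = α by ring]

/-- `σ_u (σ_u w) = w`: the inverse homeomorphism of a reflection is itself. [folklore] -/
theorem lineReflection_toHomeomorph_symm (β : ℝ) :
    (lineReflection β).toHomeomorph.symm = (lineReflection β).toHomeomorph := by
  ext1 z
  rw [Homeomorph.symm_apply_eq, LinearIsometryEquiv.coe_toHomeomorph,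
    lineReflection_lineReflection]

/-- `σ_0` is complex conjugation, as plane homeomorphisms. [folklore] -/
theorem lineReflection_zero_toHomeomorph :
    (lineReflection 0).toHomeomorph = Complex.conjCLE.toHomeomorph := by
  ext1 z
  rw [LinearIsometryEquiv.coe_toHomeomorph, lineReflection_zero_apply,
    ContinuousLinearEquiv.coe_toHomeomorph, Complex.conjCLE_apply]

namespace QuadCrossing

/-- Reflecting a quad twice in the same line gives it back. [folklore] -/
theorem Quad.mapHomeomorph_lineReflection_mapHomeomorph_lineReflection (β : ℝ)
    (Q : Quad (univ : Set ℂ)) :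
    (Q.mapHomeomorph (lineReflection β).toHomeomorph).mapHomeomorph
        (lineReflection β).toHomeomorph = Q := by
  have h := Quad.mapHomeomorph_symm_mapHomeomorph (lineReflection β).toHomeomorph Q
  rwa [lineReflection_toHomeomorph_symm] at h

/-- Membership in a reflected configuration: `Q ∈ σ_u · S ↔ σ_u ∘ Q ∈ S`. [folklore] -/
theorem QuadConfig.mem_mapHomeomorph_lineReflection {β : ℝ} {S : QuadConfig (univ : Set ℂ)}
    {Q : Quad (univ : Set ℂ)} :
    Q ∈ S.mapHomeomorph (lineReflection β).toHomeomorph ↔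
      Q.mapHomeomorph (lineReflection β).toHomeomorph ∈ S := by
  rw [QuadConfig.mem_mapHomeomorph, lineReflection_toHomeomorph_symm]

/-- Reflecting a configuration twice in the same line gives it back. [folklore] -/
theorem QuadConfig.mapHomeomorph_lineReflection_mapHomeomorph_lineReflection (β : ℝ)
    (S : QuadConfig (univ : Set ℂ)) :
    (S.mapHomeomorph (lineReflection β).toHomeomorph).mapHomeomorph
        (lineReflection β).toHomeomorph = S := by
  have h := QuadConfig.mapHomeomorph_symm_mapHomeomorph (lineReflection β).toHomeomorph S
  rwa [lineReflection_toHomeomorph_symm] at h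

/-- `e^{iα} = σ_{α/2} ∘ σ_0` on configurations: rotating by `α` is reflecting in the real axis and
then in `e^{iα/2}ℝ` ("the composition of the reflections with respect to the horizontal axis and
to `e^{iα/2}ℝ` produces the rotation by an angle `α`"). [cite: DKKMO2020Rotational, §7.1 p. 42] -/
theorem QuadConfig.rotate_eq_mapHomeomorph_lineReflection (α : ℝ) (S : QuadConfig (univ : Set ℂ)) :
    QuadConfig.rotate α S =
      (S.mapHomeomorph (lineReflection 0).toHomeomorph).mapHomeomorph
        (lineReflection (α / 2)).toHomeomorph := by
  rw [← QuadConfig.mapHomeomorph_trans]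
  unfold QuadConfig.rotate
  congr 1
  ext1 z
  rw [Homeomorph.trans_apply, LinearIsometryEquiv.coe_toHomeomorph,
    LinearIsometryEquiv.coe_toHomeomorph, LinearIsometryEquiv.coe_toHomeomorph,
    lineReflection_lineReflection_zero, show 2 * (α / 2) = α by ring]

/-- A reflection (a real-linear map) commutes with real dilations. [folklore] -/
theorem lineReflection_real_mul (β δ : ℝ) (z : ℂ) :
    lineReflection β ((δ : ℂ) * z) = (δ : ℂ) * lineReflection β z := by
  rw [lineReflection_apply, lineReflection_apply, RingHom.map_mul, Complex.conj_ofReal]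
  ring

/-- The reflected quad `σ_{α/2} Q` depends continuously on the angle `α` (uniform topology of
`𝒬_ℂ`; `continuous_mapHomeomorph_reflect`). [folklore] -/
theorem Quad.continuous_mapHomeomorph_lineReflection_half (Q : Quad (univ : Set ℂ)) :
    Continuous fun α : ℝ => Q.mapHomeomorph (lineReflection (α / 2)).toHomeomorph := by
  have h := continuous_mapHomeomorph_reflect Q
  simp only [reflectHomeomorph_eq_lineReflection] at h
  exact h

end QuadCrossing

/-! ### `σ_{α/2}` is a symmetry of `(𝕃(α), φ_{𝕃(α)})`, realised by `reflSite` -/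

/-- **`σ_{α/2}(𝕃(α)) = 𝕃(α)` on lattice points, through `reflSite`**: DKKMO's position of `𝕃(α)`
at the site `reflSite x = (x₀, -x₁)` is the mirror image in the line `e^{iα/2}ℝ` of its position
at `x` ("`𝕃(α)` is obtained by rotating the rectangular lattice by `α/2`; it has `e^{iα/2}ℝ` as
axis of symmetry"). [cite: DKKMO2020Rotational, §2.1 p. 7] -/
theorem isoRectDrawing_reflSite (α : ℝ) (x : Site 2) :
    isoRectDrawing α (reflSite x) = lineReflection (α / 2) (isoRectDrawing α x) := by
  rw [isoRectDrawing_eq_isoRectLinear, isoRectDrawing_eq_isoRectLinear, toComplex_reflSite,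
    isoRectLinear_conj_eq_circleExp_mul_conj, lineReflection_apply, show 2 * (α / 2) = α by ring]

/-- Membership of a pair in the `reflSite`-image of a configuration. [folklore] -/
theorem mk_mem_image_reflPerm_iff {ω : BondConfig (Site 2)} {x y : Site 2} :
    s(x, y) ∈ (reflPerm '' ω : Set (Sym2 (Site 2))) ↔ s(reflSite x, reflSite y) ∈ ω := by
  constructor
  · rintro ⟨e, he, hex⟩
    have h2 : reflPerm (s(x, y)) = e := by
      rw [← hex]; exact isLatticeReflection_reflSite.map_map e
    rw [← h2] at he
    simpa only [coe_reflPerm, Sym2.map_mk] using he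
  · intro h
    refine ⟨s(reflSite x, reflSite y), h, ?_⟩
    simp only [coe_reflPerm, Sym2.map_mk, reflSite_involutive x, reflSite_involutive y]

/-- `reflSite` preserves the edge set of `ℤ²`, so it commutes with the restriction of a
configuration to the lattice edges. [folklore] -/
theorem image_reflPerm_inter_edgeSet (ω : BondConfig (Site 2)) :
    (reflPerm '' ω) ∩ (zdGraph 2).edgeSet = reflPerm '' (ω ∩ (zdGraph 2).edgeSet) := by
  ext e
  constructor
  · rintro ⟨⟨e', he', rfl⟩, hE⟩
    refine ⟨e', ⟨he', ?_⟩, rfl⟩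
    exact isLatticeReflection_reflSite.map_mem_edgeSet_iff.1 (by simpa only [coe_reflPerm] using hE)
  · rintro ⟨e', ⟨he', hE⟩, rfl⟩
    refine ⟨⟨e', he', rfl⟩, ?_⟩
    simpa only [coe_reflPerm] using isLatticeReflection_reflSite.map_mem_edgeSet hE

/-- **The drawn open edges transform by `σ_{α/2}`.** The open edges of `reflSite(ω)` drawn at
mesh `δ` on `𝕃(α)` are the mirror image in `e^{iα/2}ℝ` of the open edges of `ω` drawn at mesh `δ`
on `𝕃(α)`. [cite: DKKMO2020Rotational, §2.1 p. 7] -/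
theorem openEdgeRealization_isoRectDrawing_image_reflPerm (α δ : ℝ) (ω : BondConfig (Site 2)) :
    openEdgeRealization (isoRectDrawing α) δ (reflPerm '' ω) =
      lineReflection (α / 2) '' openEdgeRealization (isoRectDrawing α) δ ω := by
  ext w
  simp only [openEdgeRealization, mem_setOf_eq, mk_mem_image_reflPerm_iff]
  simp only [mem_image, mem_setOf_eq]
  constructor
  · rintro ⟨x, y, hxy, hw⟩
    refine ⟨lineReflection (α / 2) w, ⟨reflSite x, reflSite y, hxy, ?_⟩,
      lineReflection_lineReflection (α / 2) w⟩
    have hx : isoRectDrawing α x = lineReflection (α / 2) (isoRectDrawing α (reflSite x)) := by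
      conv_lhs => rw [← reflSite_involutive x]
      exact isoRectDrawing_reflSite α (reflSite x)
    have hy : isoRectDrawing α y = lineReflection (α / 2) (isoRectDrawing α (reflSite y)) := by
      conv_lhs => rw [← reflSite_involutive y]
      exact isoRectDrawing_reflSite α (reflSite y)
    rw [hx, hy, ← lineReflection_real_mul, ← lineReflection_real_mul,
      ← image_lineReflection_segment] at hw
    obtain ⟨w₀, hw₀, rfl⟩ := hw
    rwa [lineReflection_lineReflection]
  · rintro ⟨w₀, ⟨x, y, hxy, hw₀⟩, rfl⟩
    refine ⟨reflSite x, reflSite y, ?_, ?_⟩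
    · simpa only [reflSite_involutive x, reflSite_involutive y] using hxy
    · rw [isoRectDrawing_reflSite, isoRectDrawing_reflSite, ← lineReflection_real_mul,
        ← lineReflection_real_mul, ← image_lineReflection_segment]
      exact mem_image_of_mem _ hw₀

/-- **`S^{α}_{δ}(reflSite ω) = σ_{α/2} · S^{α}_{δ}(ω)` in `ℋ_ℂ`** ("`σ_{α/2} ω^α ∼ φ_{δ𝕃(α)}`":
the configuration `reflSite(ω)` drawn on `δ𝕃(α)`, read in Schramm–Smirnov's space, is the mirror
image in `e^{iα/2}ℝ` of `ω` drawn on `δ𝕃(α)`; transport of `S_ω` along a plane homeomorphism,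
`configOf_eq_mapHomeomorph`). [cite: DKKMO2020Rotational, §7.1 p. 42 and §2.1 p. 7] -/
theorem isoRectQuadConfig_image_reflPerm (α δ : ℝ) (ω : BondConfig (Site 2)) :
    isoRectQuadConfig α δ (reflPerm '' ω) =
      (isoRectQuadConfig α δ ω).mapHomeomorph (lineReflection (α / 2)).toHomeomorph := by
  unfold isoRectQuadConfig
  rw [image_reflPerm_inter_edgeSet]
  exact configOf_eq_mapHomeomorph (lineReflection (α / 2)).toHomeomorph
    (openEdgeRealization_isoRectDrawing_image_reflPerm α δ _)

/-- **`φ_{𝕃(α)}` is `reflSite`-invariant** (the weights of `𝕃(α)` only depend on the edge being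
horizontal or vertical; `isoRectPercolation_map_reflSite` through
`prodBernoulli_isoRectCriticalProb`). [cite: DKKMO2020Rotational, §2.2 p. 7] -/
theorem prodBernoulli_isoRectCriticalProb_map_image_reflPerm (α : ℝ) :
    (prodBernoulli (isoRectCriticalProb α)).map (fun ω => reflPerm '' ω) =
      prodBernoulli (isoRectCriticalProb α) := by
  rw [prodBernoulli_isoRectCriticalProb, isoRectPercolation_map_reflSite]

/-! ### The reference configuration `S^{π/2}_{δ}` is `e^{iπ/4} · (ω)_{√2 δ}`; measurability -/

/-- **`S^{π/2}_{δ}(ω) = e^{iπ/4} · ω_{√2 δ}`**: the configuration `ω` drawn on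
`δ𝕃(π/2) = e^{iπ/4}√2 δℤ²` is, in `ℋ_ℂ`, the rotation by `π/4` of `ω` drawn on `(√2 δ)ℤ²`
(`z2QuadConfig`; `openEdgeUnionEmb_isoRectDrawing_pi_div_two`, `configOf_eq_mapHomeomorph`).
[cite: DKKMO2020Rotational, §2.1 p. 7] -/
theorem isoRectQuadConfig_pi_div_two_eq_rotate (δ : ℝ) (ω : BondConfig (Site 2)) :
    isoRectQuadConfig (π / 2) δ ω =
      QuadConfig.rotate (π / 4) (z2QuadConfig univ (Real.sqrt 2 * δ) ω) := by
  unfold isoRectQuadConfig QuadConfig.rotate z2QuadConfig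
  refine configOf_eq_mapHomeomorph (rotation (Circle.exp (π / 4))).toHomeomorph ?_
  rw [← openEdgeUnionEmb_eq_openEdgeRealization, openEdgeRealization_toComplex_inter_edgeSet,
    openEdgeUnionEmb_isoRectDrawing_pi_div_two]

/-- Hence the reference encoding `ω ↦ S^{π/2}_{δ}(ω) ∈ ℋ_ℂ` is Borel measurable for `δ > 0`
(`measurable_z2QuadConfig`, continuity of rotations of `ℋ_ℂ`). [cite: SchrammSmirnov2011, §1.3] -/
theorem measurable_isoRectQuadConfig_pi_div_two {δ : ℝ} (hδ : 0 < δ) :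
    Measurable (isoRectQuadConfig (π / 2) δ) := by
  have hfun : isoRectQuadConfig (π / 2) δ =
      QuadConfig.rotate (π / 4) ∘ z2QuadConfig univ (Real.sqrt 2 * δ) :=
    funext (isoRectQuadConfig_pi_div_two_eq_rotate δ)
  rw [hfun]
  exact (QuadConfig.measurable_rotate _).comp
    (measurable_z2QuadConfig isOpen_univ (mul_pos (Real.sqrt_pos.2 two_pos) hδ))

/-- The event "the quad `Q` is crossed in the reference configuration", `{ω : Q ∈ S^{π/2}_{δ}(ω)}`,
is measurable (`δ > 0`). [cite: SchrammSmirnov2011, §1.3] -/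
theorem measurableSet_mem_isoRectQuadConfig_pi_div_two {δ : ℝ} (hδ : 0 < δ)
    (Q : Quad (univ : Set ℂ)) :
    MeasurableSet {ω : BondConfig (Site 2) | Q ∈ isoRectQuadConfig (π / 2) δ ω} :=
  measurable_isoRectQuadConfig_pi_div_two hδ (QuadConfig.measurableSet_crossedEvent Q)

/-! ### The deterministic core: agreement forced by the two couplings, the net and (5.1) -/

/-- **Deterministic core of the reflection argument.** Three configurations of `ℋ_ℂ` — `A` (the
`𝕃(α)` sample), `B` (the reference sample) and `C` (the second reference sample) — and a plane
homeomorphism `g` (the reflection `σ_{α/2}`). Data: a target quad `Q` with its (5.1)-companions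
(`raw'`, `raw''` the raw crossing events of `Q' < Q < Q''` in the reference sample: `Q ∈ B ⟹ raw'`,
`A₄ ∉ B ⟹ ¬raw''`, `D₄ ∈ B ⟹ raw'`, `Q ∉ B ⟹ ¬raw''` for the chains `Q < … < A₄ < Q''`,
`Q' < D₄ < … < Q`), the pieces of the first coupling `(A, B)` at the fixed quads `A₃ < A₄`,
`D₄ < D₃`, the pieces of the second coupling `(g · A, C)` at the fixed quads `X₁ < X₂`, `Y₂ < Y₁`
(images of `A₁ < A₂`, `D₂ < D₁` by the reflection of the net angle), the net conditions pinning
the moving quads (`R = σ_{α/2} Q < X₁`, `g⁻¹ X₂ < A₃`, `Y₁ < R`, `D₃ < g⁻¹ Y₂`), and the absence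
of the (5.1)-event `raw' ∧ ¬raw''`. Conclusion: `Q ∈ B ↔ R ∈ C`. Passing to easier quads is free
(configurations are lower sets; `int ⊞_P ⊆ ⊞_P`); the single passage to a harder quad is the
excluded (5.1)-event. [cite: DKKMO2020Rotational, §7.1 p. 42; SchrammSmirnov2011, §1.3 and (5.1)] -/
theorem QuadCrossing.QuadConfig.iff_of_pieces {A B C : QuadConfig (univ : Set ℂ)} (g : ℂ ≃ₜ ℂ)
    {Q R A₃ A₄ D₃ D₄ X₁ X₂ Y₁ Y₂ : Quad (univ : Set ℂ)} {raw' raw'' : Prop}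
    (r1 : Q ∈ B → raw') (r2 : A₄ ∉ B → ¬ raw'') (r3 : D₄ ∈ B → raw') (r4 : Q ∉ B → ¬ raw'')
    (hE : ¬ (raw' ∧ ¬ raw''))
    (p1 : A₄ ∈ B → A ∈ interior (crossedEvent A₃))
    (p2 : D₃ ∈ A → B ∈ interior (crossedEvent D₄))
    (p3 : X₂ ∈ A.mapHomeomorph g → C ∈ interior (crossedEvent X₁))
    (p4 : Y₁ ∈ C → A.mapHomeomorph g ∈ interior (crossedEvent Y₂))
    (c1 : Quad.StrictlyDominated R X₁) (c2 : Quad.StrictlyDominated (X₂.mapHomeomorph g.symm) A₃)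
    (c3 : Quad.StrictlyDominated Y₁ R) (c4 : Quad.StrictlyDominated D₃ (Y₂.mapHomeomorph g.symm)) :
    Q ∈ B ↔ R ∈ C := by
  constructor
  · intro hQB
    by_contra hRC
    refine hE ⟨r1 hQB, r2 fun hA₄ => ?_⟩
    -- `A₄ ∈ B` propagates down to `R ∈ C`
    have hA₃ : A₃ ∈ A := interior_subset (s := crossedEvent A₃) (p1 hA₄)
    have hX₂ : X₂ ∈ A.mapHomeomorph g := by
      rw [QuadConfig.mem_mapHomeomorph]
      exact A.isLowerQuadSet hA₃ c2
    have hX₁ : X₁ ∈ C := interior_subset (s := crossedEvent X₁) (p3 hX₂)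
    exact hRC (C.isLowerQuadSet hX₁ c1)
  · intro hRC
    by_contra hQB
    refine hE ⟨r3 ?_, r4 hQB⟩
    -- `R ∈ C` propagates down to `D₄ ∈ B`
    have hY₁ : Y₁ ∈ C := C.isLowerQuadSet hRC c3
    have hY₂ : Y₂ ∈ A.mapHomeomorph g := interior_subset (s := crossedEvent Y₂) (p4 hY₁)
    rw [QuadConfig.mem_mapHomeomorph] at hY₂
    have hD₃ : D₃ ∈ A := A.isLowerQuadSet hY₂ c4
    exact interior_subset (s := crossedEvent D₄) (p2 hD₃)

/-- The piece `{(S, S') : P⁺ ∈ S' → S ∈ int ⊞_{P⁻}}` of Schramm–Smirnov's topology on pairs is open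
(`V^{P⁺}` and `int ⊞_{P⁻}` are open). [cite: SchrammSmirnov2011, §1.3] -/
theorem QuadCrossing.QuadConfig.isOpen_setOf_mem_snd_imp {Pm Pp : Quad (univ : Set ℂ)} :
    IsOpen {p : QuadConfig (univ : Set ℂ) × QuadConfig (univ : Set ℂ) |
      Pp ∈ p.2 → p.1 ∈ interior (crossedEvent Pm)} := by
  have : {p : QuadConfig (univ : Set ℂ) × QuadConfig (univ : Set ℂ) |
      Pp ∈ p.2 → p.1 ∈ interior (crossedEvent Pm)} =
      Prod.snd ⁻¹' notCrossed Pp ∪ Prod.fst ⁻¹' interior (crossedEvent Pm) := by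
    ext p
    simp only [mem_setOf_eq, mem_union, mem_preimage, notCrossed, imp_iff_not_or]
  rw [this]
  exact ((isOpen_notCrossed Pp).preimage continuous_snd).union
    (isOpen_interior.preimage continuous_fst)

/-- The piece `{(S, S') : P⁺ ∈ S → S' ∈ int ⊞_{P⁻}}` is open. [cite: SchrammSmirnov2011, §1.3] -/
theorem QuadCrossing.QuadConfig.isOpen_setOf_mem_fst_imp {Pm Pp : Quad (univ : Set ℂ)} :
    IsOpen {p : QuadConfig (univ : Set ℂ) × QuadConfig (univ : Set ℂ) |
      Pp ∈ p.1 → p.2 ∈ interior (crossedEvent Pm)} := by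
  have : {p : QuadConfig (univ : Set ℂ) × QuadConfig (univ : Set ℂ) |
      Pp ∈ p.1 → p.2 ∈ interior (crossedEvent Pm)} =
      Prod.fst ⁻¹' notCrossed Pp ∪ Prod.snd ⁻¹' interior (crossedEvent Pm) := by
    ext p
    simp only [mem_setOf_eq, mem_union, mem_preimage, notCrossed, imp_iff_not_or]
  rw [this]
  exact ((isOpen_notCrossed Pp).preimage continuous_fst).union
    (isOpen_interior.preimage continuous_snd)

/-- The disagreement event of two measurable events is measurable. [folklore] -/
theorem measurableSet_setOf_not_iff {X : Type*} [MeasurableSpace X] {s t : Set X}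
    (hs : MeasurableSet s) (ht : MeasurableSet t) : MeasurableSet {x | ¬ (x ∈ s ↔ x ∈ t)} := by
  have : {x | ¬ (x ∈ s ↔ x ∈ t)} = symmDiff s t := by
    ext x
    simp only [mem_setOf_eq, Set.mem_symmDiff]
    tauto
  rw [this]
  exact hs.symmDiff ht

/-- `ε / (4(n+1))`-budgets sum to at most `ε / 4` over `n` pieces. [folklore] -/
theorem natCast_mul_ofReal_div_four_le (n : ℕ) {ε : ℝ} (hε : 0 ≤ ε) :
    (n : ℝ≥0∞) * ENNReal.ofReal (ε / (4 * (n + 1))) ≤ ENNReal.ofReal (ε / 4) := by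
  rw [← ENNReal.ofReal_natCast, ← ENNReal.ofReal_mul (Nat.cast_nonneg n)]
  refine ENNReal.ofReal_le_ofReal ?_
  rw [← mul_div_assoc, div_le_iff₀ (by positivity)]
  nlinarith [mul_nonneg (Nat.cast_nonneg (α := ℝ) n) hε]

/-! ### Asymptotic invariance of `φ_{δ𝕃(π/2)}` under `σ_{α/2}`, on finitely many quads -/

/-- **Asymptotic reflection invariance of the reference lattice, uniformly in the angle.** Assume
`DKKMO2020_thm21_schrammSmirnov` and Schramm–Smirnov's (5.1) for critical bond percolation on
`δℤ²`. For every `ε > 0` and every finite family `F` of quads there is `δ₀ > 0` such that for all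
`α ∈ (ε, π - ε)` and `0 < δ ≤ δ₀` some coupling of `φ_{δ𝕃(π/2)}` with itself makes, for every
`Q ∈ F`, the crossing indicator of `Q` in `S^{π/2}_{ω}` and of `σ_{α/2} Q` in `S^{π/2}_{ω''}`
agree off an event of probability `< ε` (v2 §4.1: "(4) implies that `φ_{𝕃(π/2)}` is
asymptotically invariant under the reflection with respect to `e^{iα/2}ℝ`"; v1 §7.1 p. 42). The
coupling is the gluing, along the `𝕃(α)` sample `ω^α`, of a coupling `(ω^α, ω)` of Theorem 2.1
inside a neighbourhood built from fixed quads and of the image under `reflSite × id` of a coupling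
`(reflSite ω^α, ω'')` of Theorem 2.1 inside a second such neighbourhood (the pieces at the quads
`σ_{α₀/2} A_i` for the finitely many net angles `α₀`); see the module docstring.
[cite: DKKMO2020Rotational, §7.1 p. 42; SchrammSmirnov2011, (5.1)] -/
theorem finiteQuads_reflection_of_thm21_schrammSmirnov (h : DKKMO2020_thm21_schrammSmirnov)
    (hcont : ∀ (Q₀ : Quad (univ : Set ℂ)) (ε : ℝ≥0∞), 0 < ε →
      ∃ Q' Q'' : Quad (univ : Set ℂ), Quad.StrictlyDominated Q' Q₀ ∧ Quad.StrictlyDominated Q₀ Q'' ∧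
        ∃ δ₀ : ℝ, 0 < δ₀ ∧ ∀ δ : ℝ, 0 < δ → δ < δ₀ →
          bondPercolation (zdGraph 2) half
            {ω | (∃ K, Q'.IsCrossing K ∧ K ⊆ openEdgeUnion δ ω) ∧
              ¬ ∃ K, Q''.IsCrossing K ∧ K ⊆ openEdgeUnion δ ω} ≤ ε)
    {ε : ℝ} (hε : 0 < ε) (F : Finset (Quad (univ : Set ℂ))) :
    ∃ δ₀ : ℝ, 0 < δ₀ ∧ ∀ α ∈ Ioo ε (π - ε), ∀ δ : ℝ, 0 < δ → δ ≤ δ₀ →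
      ∃ P : Measure (BondConfig (Site 2) × BondConfig (Site 2)),
        P.map Prod.fst = prodBernoulli (isoRectCriticalProb (π / 2)) ∧
        P.map Prod.snd = prodBernoulli (isoRectCriticalProb (π / 2)) ∧
        P {p | ∃ Q ∈ F, ¬ (Q ∈ isoRectQuadConfig (π / 2) δ p.1 ↔
          Q.mapHomeomorph (lineReflection (α / 2)).toHomeomorph ∈
            isoRectQuadConfig (π / 2) δ p.2)} < ENNReal.ofReal ε := by
  classical
  haveI : Nonempty (Quad (univ : Set ℂ)) := ⟨Quad.unitSquare⟩
  haveI : StandardBorelSpace (BondConfig (Site 2)) := standardBorelSpace_bondConfig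
  -- notation: the reflections, the reference encoding, the reference measure
  set sg : ℝ → ℂ ≃ₜ ℂ := fun a => (lineReflection (a / 2)).toHomeomorph with hσ
  have hσsymm : ∀ a, (sg a).symm = sg a := fun a => lineReflection_toHomeomorph_symm (a / 2)
  have hσσ : ∀ a (X : Quad (univ : Set ℂ)), (X.mapHomeomorph (sg a)).mapHomeomorph (sg a) = X :=
    fun a X => Quad.mapHomeomorph_lineReflection_mapHomeomorph_lineReflection (a / 2) X
  have hσc : ∀ X : Quad (univ : Set ℂ), Continuous fun a => X.mapHomeomorph (sg a) :=
    fun X => Quad.continuous_mapHomeomorph_lineReflection_half X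
  set φ : Measure (BondConfig (Site 2)) := prodBernoulli (isoRectCriticalProb (π / 2)) with hφ
  have hφZ : φ = bondPercolation (zdGraph 2) half := prodBernoulli_isoRectCriticalProb_pi_div_two
  -- Step 1: Schramm–Smirnov continuity (5.1) on `δ𝕃(π/2)` at every quad, budget `ε / (4(n+1))`
  set n : ℕ := F.card with hn
  have hηpos : 0 < ε / (4 * (n + 1)) := by positivity
  have hη0 : 0 < ENNReal.ofReal (ε / (4 * (n + 1))) := ENNReal.ofReal_pos.2 hηpos
  have key : ∀ Q : Quad (univ : Set ℂ), ∃ (Q' Q'' : Quad (univ : Set ℂ)) (δ₁ : ℝ),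
      Quad.StrictlyDominated Q' Q ∧ Quad.StrictlyDominated Q Q'' ∧ 0 < δ₁ ∧
        ∀ δ : ℝ, 0 < δ → δ < δ₁ →
          bondPercolation (zdGraph 2) half
            {ω | (∃ K, Q'.IsCrossing K ∧ K ⊆ openEdgeUnionEmb (isoRectDrawing (π / 2)) δ ω) ∧
              ¬ ∃ K, Q''.IsCrossing K ∧ K ⊆ openEdgeUnionEmb (isoRectDrawing (π / 2)) δ ω} ≤
            ENNReal.ofReal (ε / (4 * (n + 1))) := fun Q => by
    obtain ⟨Q', Q'', h', h'', δ₁, hδ₁, hE⟩ := continuity_isoRectDrawing_pi_div_two hcont Q hη0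
    exact ⟨Q', Q'', δ₁, h', h'', hδ₁, hE⟩
  choose Qm Qp δ₁ hQm hQp hδ₁ hE using key
  -- the raw crossing events and the (5.1)-events of the reference configuration
  set raw : Quad (univ : Set ℂ) → ℝ → BondConfig (Site 2) → Prop := fun X δ ω =>
    ∃ K, X.IsCrossing K ∧ K ⊆ openEdgeUnionEmb (isoRectDrawing (π / 2)) δ ω with hraw
  -- Step 2: the chains `Q' < D₄ < D₃ < D₂ < D₁ < Q < A₁ < A₂ < A₃ < A₄ < Q''`
  have hA : ∀ Q : Quad (univ : Set ℂ), ∃ A₁ A₂ A₃ A₄ : Quad (univ : Set ℂ),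
      Quad.StrictlyDominated Q A₁ ∧ Quad.StrictlyDominated A₁ A₂ ∧ Quad.StrictlyDominated A₂ A₃ ∧
        Quad.StrictlyDominated A₃ A₄ ∧ Quad.StrictlyDominated A₄ (Qp Q) := fun Q => by
    obtain ⟨A₁, h₁, h₁'⟩ := Quad.exists_strictlyDominated_between isOpen_univ (hQp Q)
    obtain ⟨A₂, h₂, h₂'⟩ := Quad.exists_strictlyDominated_between isOpen_univ h₁'
    obtain ⟨A₃, h₃, h₃'⟩ := Quad.exists_strictlyDominated_between isOpen_univ h₂'
    obtain ⟨A₄, h₄, h₄'⟩ := Quad.exists_strictlyDominated_between isOpen_univ h₃'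
    exact ⟨A₁, A₂, A₃, A₄, h₁, h₂, h₃, h₄, h₄'⟩
  choose A₁ A₂ A₃ A₄ hQA₁ hA₁₂ hA₂₃ hA₃₄ hA₄p using hA
  have hD : ∀ Q : Quad (univ : Set ℂ), ∃ D₁ D₂ D₃ D₄ : Quad (univ : Set ℂ),
      Quad.StrictlyDominated (Qm Q) D₄ ∧ Quad.StrictlyDominated D₄ D₃ ∧ Quad.StrictlyDominated D₃ D₂ ∧
        Quad.StrictlyDominated D₂ D₁ ∧ Quad.StrictlyDominated D₁ Q := fun Q => by
    obtain ⟨D₁, h₁, h₁'⟩ := Quad.exists_strictlyDominated_between isOpen_univ (hQm Q)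
    obtain ⟨D₂, h₂, h₂'⟩ := Quad.exists_strictlyDominated_between isOpen_univ h₁
    obtain ⟨D₃, h₃, h₃'⟩ := Quad.exists_strictlyDominated_between isOpen_univ h₂
    obtain ⟨D₄, h₄, h₄'⟩ := Quad.exists_strictlyDominated_between isOpen_univ h₃
    exact ⟨D₁, D₂, D₃, D₄, h₄, h₄', h₃', h₂', h₁'⟩
  choose D₁ D₂ D₃ D₄ hmD₄ hD₄₃ hD₃₂ hD₂₁ hD₁Q using hD
  -- Step 3: the first neighbourhood (pieces at the fixed quads `A₃ < A₄`, `D₄ < D₃`)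
  set N₁ : Set (QuadConfig (univ : Set ℂ) × QuadConfig (univ : Set ℂ)) :=
    {p | ∀ Q ∈ F, (A₄ Q ∈ p.2 → p.1 ∈ interior (QuadConfig.crossedEvent (A₃ Q))) ∧
      (D₃ Q ∈ p.1 → p.2 ∈ interior (QuadConfig.crossedEvent (D₄ Q)))} with hN₁
  have hN₁o : IsOpen N₁ := by
    have : N₁ = ⋂ Q ∈ F, ({p : QuadConfig (univ : Set ℂ) × QuadConfig (univ : Set ℂ) |
        A₄ Q ∈ p.2 → p.1 ∈ interior (QuadConfig.crossedEvent (A₃ Q))} ∩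
        {p | D₃ Q ∈ p.1 → p.2 ∈ interior (QuadConfig.crossedEvent (D₄ Q))}) := by
      ext p; simp only [hN₁, mem_setOf_eq, mem_iInter, mem_inter_iff]
    rw [this]
    exact isOpen_biInter_finset fun Q _ =>
      QuadConfig.isOpen_setOf_mem_snd_imp.inter QuadConfig.isOpen_setOf_mem_fst_imp
  have hN₁d : ∀ S, (S, S) ∈ N₁ := fun S Q _ =>
    ⟨fun h4 => QuadConfig.mem_interior_crossedEvent_of_mem (hA₃₄ Q) h4,
      fun h3 => QuadConfig.mem_interior_crossedEvent_of_mem (hD₄₃ Q) h3⟩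
  -- Step 4: the net of angles (compactness of `[ε, π - ε]`, `<` open, `α ↦ σ_{α/2} X` continuous)
  set U : ℝ → Set ℝ := fun α₀ => {α | ∀ Q ∈ F,
      Quad.StrictlyDominated (Q.mapHomeomorph (sg α)) ((A₁ Q).mapHomeomorph (sg α₀)) ∧
      Quad.StrictlyDominated (((A₂ Q).mapHomeomorph (sg α₀)).mapHomeomorph (sg α)) (A₃ Q) ∧
      Quad.StrictlyDominated ((D₁ Q).mapHomeomorph (sg α₀)) (Q.mapHomeomorph (sg α)) ∧
      Quad.StrictlyDominated (D₃ Q) (((D₂ Q).mapHomeomorph (sg α₀)).mapHomeomorph (sg α))}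
    with hU
  have hUo : ∀ α₀, IsOpen (U α₀) := fun α₀ => by
    have : U α₀ = ⋂ Q ∈ F, ({α | Quad.StrictlyDominated (Q.mapHomeomorph (sg α))
        ((A₁ Q).mapHomeomorph (sg α₀))} ∩
      {α | Quad.StrictlyDominated (((A₂ Q).mapHomeomorph (sg α₀)).mapHomeomorph (sg α)) (A₃ Q)} ∩
      {α | Quad.StrictlyDominated ((D₁ Q).mapHomeomorph (sg α₀)) (Q.mapHomeomorph (sg α))} ∩
      {α | Quad.StrictlyDominated (D₃ Q) (((D₂ Q).mapHomeomorph (sg α₀)).mapHomeomorph (sg α))}) := by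
      ext α; simp only [hU, mem_setOf_eq, mem_iInter, mem_inter_iff, and_assoc]
    rw [this]
    refine isOpen_biInter_finset fun Q _ => ((IsOpen.inter ?_ ?_).inter ?_).inter ?_
    · exact isOpen_interior.preimage ((hσc Q).prodMk continuous_const)
    · exact isOpen_interior.preimage ((hσc _).prodMk continuous_const)
    · exact isOpen_interior.preimage (continuous_const.prodMk (hσc Q))
    · exact isOpen_interior.preimage (continuous_const.prodMk (hσc _))
  have hU0 : ∀ α₀, α₀ ∈ U α₀ := fun α₀ Q _ => by
    refine ⟨(hQA₁ Q).mapHomeomorph (sg α₀), ?_, (hD₁Q Q).mapHomeomorph (sg α₀), ?_⟩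
    · rw [hσσ]; exact hA₂₃ Q
    · rw [hσσ]; exact hD₃₂ Q
  obtain ⟨t, -, hcover⟩ := (isCompact_Icc : IsCompact (Icc ε (π - ε))).elim_nhds_subcover U
    fun α₀ _ => (hUo α₀).mem_nhds (hU0 α₀)
  -- Step 5: the second neighbourhood (pieces at the quads `σ_{α₀/2} A₁ < σ_{α₀/2} A₂`,
  -- `σ_{α₀/2} D₂ < σ_{α₀/2} D₁`, `α₀` in the net)
  set N₂ : Set (QuadConfig (univ : Set ℂ) × QuadConfig (univ : Set ℂ)) :=
    {p | ∀ α₀ ∈ t, ∀ Q ∈ F,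
      ((A₂ Q).mapHomeomorph (sg α₀) ∈ p.1 →
        p.2 ∈ interior (QuadConfig.crossedEvent ((A₁ Q).mapHomeomorph (sg α₀)))) ∧
      ((D₁ Q).mapHomeomorph (sg α₀) ∈ p.2 →
        p.1 ∈ interior (QuadConfig.crossedEvent ((D₂ Q).mapHomeomorph (sg α₀))))} with hN₂
  have hN₂o : IsOpen N₂ := by
    have : N₂ = ⋂ α₀ ∈ t, ⋂ Q ∈ F, ({p : QuadConfig (univ : Set ℂ) × QuadConfig (univ : Set ℂ) |
        (A₂ Q).mapHomeomorph (sg α₀) ∈ p.1 →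
          p.2 ∈ interior (QuadConfig.crossedEvent ((A₁ Q).mapHomeomorph (sg α₀)))} ∩
        {p | (D₁ Q).mapHomeomorph (sg α₀) ∈ p.2 →
          p.1 ∈ interior (QuadConfig.crossedEvent ((D₂ Q).mapHomeomorph (sg α₀)))}) := by
      ext p; simp only [hN₂, mem_setOf_eq, mem_iInter, mem_inter_iff]
    rw [this]
    exact isOpen_biInter_finset fun α₀ _ => isOpen_biInter_finset fun Q _ =>
      QuadConfig.isOpen_setOf_mem_fst_imp.inter QuadConfig.isOpen_setOf_mem_snd_imp
  have hN₂d : ∀ S, (S, S) ∈ N₂ := fun S α₀ _ Q _ =>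
    ⟨fun h2 => QuadConfig.mem_interior_crossedEvent_of_mem ((hA₁₂ Q).mapHomeomorph (sg α₀)) h2,
      fun h1 => QuadConfig.mem_interior_crossedEvent_of_mem ((hD₂₁ Q).mapHomeomorph (sg α₀)) h1⟩
  -- Step 6: Theorem 2.1 in the two neighbourhoods, and the mesh threshold
  have hε4 : 0 < ε / 4 := by positivity
  obtain ⟨δa, hδa, Ha⟩ := h (ε / 4) hε4 N₁ hN₁o hN₁d
  obtain ⟨δb, hδb, Hb⟩ := h (ε / 4) hε4 N₂ hN₂o hN₂d
  obtain ⟨δ₂, hδ₂, hδ₂le⟩ := exists_pos_forall_le_of_finset F δ₁ hδ₁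
  refine ⟨min (min δa δb) (δ₂ / 2), by positivity, fun α hα δ hδ hδle => ?_⟩
  have hδa' : δ ≤ δa := hδle.trans ((min_le_left _ _).trans (min_le_left _ _))
  have hδb' : δ ≤ δb := hδle.trans ((min_le_left _ _).trans (min_le_right _ _))
  have hδ₁lt : ∀ Q ∈ F, δ < δ₁ Q := fun Q hQ =>
    (hδle.trans (min_le_right _ _)).trans_lt ((half_lt_self hδ₂).trans_le (hδ₂le Q hQ))
  have hα4 : α ∈ Ioo (ε / 4) (π - ε / 4) := ⟨by linarith [hα.1], by linarith [hα.2]⟩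
  obtain ⟨α₀, hα₀t, hαU⟩ := mem_iUnion₂.1 (hcover (Ioo_subset_Icc_self hα))
  obtain ⟨P₁, hP₁f, hP₁s, hP₁⟩ := Ha α hα4 δ hδ hδa'
  obtain ⟨P₂, hP₂f, hP₂s, hP₂⟩ := Hb α hα4 δ hδ hδb'
  haveI : IsProbabilityMeasure P₁ := ⟨by
    rw [← Set.preimage_univ (f := (Prod.fst : BondConfig (Site 2) × BondConfig (Site 2) → _)),
      ← Measure.map_apply measurable_fst MeasurableSet.univ, hP₁f, measure_univ]⟩
  haveI : IsProbabilityMeasure P₂ := ⟨by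
    rw [← Set.preimage_univ (f := (Prod.fst : BondConfig (Site 2) × BondConfig (Site 2) → _)),
      ← Measure.map_apply measurable_fst MeasurableSet.univ, hP₂f, measure_univ]⟩
  -- Step 7: measurable envelopes of the three exceptional events
  obtain ⟨A₀, hA₀sub, hA₀m, hA₀eq⟩ := exists_measurable_superset P₁
    {p | (isoRectQuadConfig α δ p.1, isoRectQuadConfig (π / 2) δ p.2) ∉ N₁}
  obtain ⟨B₀, hB₀sub, hB₀m, hB₀eq⟩ := exists_measurable_superset P₂
    {p | (isoRectQuadConfig α δ p.1, isoRectQuadConfig (π / 2) δ p.2) ∉ N₂}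
  obtain ⟨E₀, hE₀sub, hE₀m, hE₀eq⟩ := exists_measurable_superset φ
    (⋃ Q ∈ F, {ω | raw (Qm Q) δ ω ∧ ¬ raw (Qp Q) δ ω})
  have hA₀lt : P₁ A₀ < ENNReal.ofReal (ε / 4) := by rw [hA₀eq]; exact hP₁
  have hB₀lt : P₂ B₀ < ENNReal.ofReal (ε / 4) := by rw [hB₀eq]; exact hP₂
  have hE₀le : φ E₀ ≤ ENNReal.ofReal (ε / 4) := by
    rw [hE₀eq]
    calc φ (⋃ Q ∈ F, {ω | raw (Qm Q) δ ω ∧ ¬ raw (Qp Q) δ ω})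
        ≤ ∑ Q ∈ F, φ {ω | raw (Qm Q) δ ω ∧ ¬ raw (Qp Q) δ ω} := measure_biUnion_finset_le _ _
      _ ≤ ∑ Q ∈ F, ENNReal.ofReal (ε / (4 * (n + 1))) := Finset.sum_le_sum fun Q hQ => by
          rw [hφZ]; exact hE Q δ hδ (hδ₁lt Q hQ)
      _ = n * ENNReal.ofReal (ε / (4 * (n + 1))) := by rw [Finset.sum_const, nsmul_eq_mul]
      _ ≤ ENNReal.ofReal (ε / 4) := natCast_mul_ofReal_div_four_le n hε.le
  -- Step 8: reflect the `𝕃(α)` coordinate of the second coupling (`σ_{α/2} ω^α ∼ φ_{δ𝕃(α)}`)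
  let ρ : BondConfig (Site 2) ≃ᵐ BondConfig (Site 2) :=
    ⟨Equiv.Set.congr reflPerm, measurable_image_equiv _, measurable_image_equiv _⟩
  have hρρ : ∀ ω : BondConfig (Site 2), ρ (ρ ω) = ω := fun ω => by
    change reflPerm '' (reflPerm '' ω) = ω
    simp only [coe_reflPerm]
    exact isLatticeReflection_reflSite.image_image ω
  let e : BondConfig (Site 2) × BondConfig (Site 2) ≃ᵐ BondConfig (Site 2) × BondConfig (Site 2) :=
    MeasurableEquiv.prodCongr ρ (MeasurableEquiv.refl _)
  have he : ∀ p : BondConfig (Site 2) × BondConfig (Site 2), e p = (reflPerm '' p.1, p.2) :=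
    fun p => rfl
  set Qb : Measure (BondConfig (Site 2) × BondConfig (Site 2)) := P₂.map e with hQb
  have hQbf : Qb.map Prod.fst = prodBernoulli (isoRectCriticalProb α) := by
    rw [hQb, Measure.map_map measurable_fst e.measurable]
    have : Prod.fst ∘ ⇑e = (fun ω : BondConfig (Site 2) => reflPerm '' ω) ∘ Prod.fst := rfl
    rw [this, ← Measure.map_map (measurable_image_equiv reflPerm) measurable_fst, hP₂f,
      prodBernoulli_isoRectCriticalProb_map_image_reflPerm]
  have hQbs : Qb.map Prod.snd = φ := by
    rw [hQb, Measure.map_map measurable_snd e.measurable]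
    have : Prod.snd ∘ ⇑e = (Prod.snd : BondConfig (Site 2) × BondConfig (Site 2) → _) := rfl
    rw [this, hP₂s]
  haveI : IsFiniteMeasure Qb := by rw [hQb]; infer_instance
  set B : Set (BondConfig (Site 2) × BondConfig (Site 2)) := e ⁻¹' B₀ with hB
  have hBm : MeasurableSet B := e.measurable hB₀m
  have hQbB : Qb B = P₂ B₀ := by
    rw [hQb, MeasurableEquiv.map_apply, hB, ← preimage_comp]
    congr 1
    ext p
    simp only [mem_preimage, comp_apply, he]
    change (reflPerm '' (reflPerm '' p.1), p.2) ∈ B₀ ↔ p ∈ B₀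
    rw [show reflPerm '' (reflPerm '' p.1) = p.1 from hρρ p.1]
  -- Step 9: the first coupling with the reference coordinate first
  set Pa : Measure (BondConfig (Site 2) × BondConfig (Site 2)) := P₁.map Prod.swap with hPa
  have hPaf : Pa.map Prod.fst = φ := by
    rw [hPa, Measure.map_map measurable_fst measurable_swap]
    exact hP₁s
  have hPas : Pa.map Prod.snd = prodBernoulli (isoRectCriticalProb α) := by
    rw [hPa, Measure.map_map measurable_snd measurable_swap]
    exact hP₁f
  haveI : IsFiniteMeasure Pa := by rw [hPa]; infer_instance
  set A : Set (BondConfig (Site 2) × BondConfig (Site 2)) := Prod.swap ⁻¹' A₀ ∪ E₀ ×ˢ univ with hAdef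
  have hAm : MeasurableSet A := (measurable_swap hA₀m).union (hE₀m.prod MeasurableSet.univ)
  have hPaA : Pa A ≤ P₁ A₀ + φ E₀ := by
    calc Pa A ≤ Pa (Prod.swap ⁻¹' A₀) + Pa (E₀ ×ˢ univ) := measure_union_le _ _
      _ = P₁ A₀ + φ E₀ := by
          congr 1
          · rw [hPa, Measure.map_apply measurable_swap (measurable_swap hA₀m), ← preimage_comp,
              Prod.swap_swap_eq, preimage_id]
          · rw [hPa, Measure.map_apply measurable_swap (hE₀m.prod MeasurableSet.univ), hφ, ← hP₁s,
              Measure.map_apply measurable_snd hE₀m]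
            congr 1
            ext p
            simp only [mem_preimage, mem_prod, mem_univ, and_true, Prod.fst_swap]
  -- Step 10: the target event and the gluing
  set C : Set (BondConfig (Site 2) × BondConfig (Site 2)) :=
    {p | ∃ Q ∈ F, ¬ (Q ∈ isoRectQuadConfig (π / 2) δ p.1 ↔
      Q.mapHomeomorph (sg α) ∈ isoRectQuadConfig (π / 2) δ p.2)} with hCdef
  have hCm : MeasurableSet C := by
    have : C = ⋃ Q ∈ F, {p : BondConfig (Site 2) × BondConfig (Site 2) |
        ¬ (p ∈ Prod.fst ⁻¹' {ω | Q ∈ isoRectQuadConfig (π / 2) δ ω} ↔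
          p ∈ Prod.snd ⁻¹' {ω | Q.mapHomeomorph (sg α) ∈ isoRectQuadConfig (π / 2) δ ω})} := by
      ext p; simp only [hCdef, mem_setOf_eq, mem_iUnion, mem_preimage, exists_prop]
    rw [this]
    exact Finset.measurableSet_biUnion F fun Q _ => measurableSet_setOf_not_iff
      ((measurableSet_mem_isoRectQuadConfig_pi_div_two hδ Q).preimage measurable_fst)
      ((measurableSet_mem_isoRectQuadConfig_pi_div_two hδ _).preimage measurable_snd)
  have himp : ∀ a b c : BondConfig (Site 2), (a, c) ∈ C → (a, b) ∈ A ∨ (b, c) ∈ B := by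
    intro a b c hac
    by_contra hcon
    push Not at hcon
    obtain ⟨hab, hbc⟩ := hcon
    -- unpack the complements of the envelopes
    have hN₁mem : (isoRectQuadConfig α δ b, isoRectQuadConfig (π / 2) δ a) ∈ N₁ := by
      by_contra h'
      exact hab (Or.inl (hA₀sub h'))
    have haE : a ∉ ⋃ Q ∈ F, {ω | raw (Qm Q) δ ω ∧ ¬ raw (Qp Q) δ ω} := fun h' =>
      hab (Or.inr ⟨hE₀sub h', mem_univ _⟩)
    have hN₂mem : ((isoRectQuadConfig α δ b).mapHomeomorph (sg α), isoRectQuadConfig (π / 2) δ c) ∈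
        N₂ := by
      by_contra h'
      refine hbc ?_
      change e (b, c) ∈ B₀
      refine hB₀sub ?_
      change (isoRectQuadConfig α δ (reflPerm '' b), isoRectQuadConfig (π / 2) δ c) ∉ N₂
      rwa [isoRectQuadConfig_image_reflPerm]
    obtain ⟨Q, hQF, hQ⟩ := hac
    refine hQ (QuadConfig.iff_of_pieces (sg α) (raw' := raw (Qm Q) δ a) (raw'' := raw (Qp Q) δ a)
      (fun hQa => exists_isCrossing_of_mem_isoRectQuadConfig (hQm Q) hQa)
      (fun hA₄ => not_exists_isCrossing_of_not_mem_isoRectQuadConfig (hA₄p Q) hA₄)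
      (fun hD₄ => exists_isCrossing_of_mem_isoRectQuadConfig (hmD₄ Q) hD₄)
      (fun hQa => not_exists_isCrossing_of_not_mem_isoRectQuadConfig (hQp Q) hQa)
      (fun h' => haE (mem_iUnion₂.2 ⟨Q, hQF, h'⟩))
      (hN₁mem Q hQF).1 (hN₁mem Q hQF).2 (hN₂mem α₀ hα₀t Q hQF).1 (hN₂mem α₀ hα₀t Q hQF).2
      (hαU Q hQF).1 ?_ (hαU Q hQF).2.2.1 ?_)
    · rw [hσsymm]; exact (hαU Q hQF).2.1
    · rw [hσsymm]; exact (hαU Q hQF).2.2.2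
  obtain ⟨T, hT₁, hT₂, hT⟩ :=
    LoopConfig.exists_glued_coupling Pa Qb (hPas.trans hQbf.symm)
  refine ⟨T, hT₁.trans hPaf, hT₂.trans hQbs, ?_⟩
  calc T C ≤ Pa A + Qb B := hT hAm hBm hCm himp
    _ ≤ (P₁ A₀ + φ E₀) + P₂ B₀ := by rw [hQbB]; exact add_le_add hPaA le_rfl
    _ < (ENNReal.ofReal (ε / 4) + ENNReal.ofReal (ε / 4)) + ENNReal.ofReal (ε / 4) := by
        refine ENNReal.add_lt_add ?_ hB₀lt
        exact ENNReal.add_lt_add_of_lt_of_le (measure_ne_top φ E₀) hA₀lt hE₀le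
    _ ≤ ENNReal.ofReal ε := by
        rw [← ENNReal.ofReal_add (by positivity) (by positivity),
          ← ENNReal.ofReal_add (by positivity) (by positivity)]
        exact ENNReal.ofReal_le_ofReal (by linarith)

/-! ### From the reflection `σ_{α/2}` to the rotation `e^{iα} = σ_{α/2} ∘ σ_0` -/

/-- Rotations of configurations compose. [folklore] -/
theorem QuadCrossing.QuadConfig.rotate_rotate (a b : ℝ) (S : QuadConfig (univ : Set ℂ)) :
    QuadConfig.rotate a (QuadConfig.rotate b S) = QuadConfig.rotate (a + b) S := by
  unfold QuadConfig.rotate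
  rw [← QuadConfig.mapHomeomorph_trans]
  congr 1
  ext1 z
  rw [Homeomorph.trans_apply, LinearIsometryEquiv.coe_toHomeomorph,
    LinearIsometryEquiv.coe_toHomeomorph, LinearIsometryEquiv.coe_toHomeomorph, rotation_apply,
    rotation_apply, rotation_apply, Circle.exp_add, Circle.coe_mul]
  ring

/-- **Asymptotic rotation invariance of `φ_{δ𝕃(π/2)}` on finitely many quads, uniformly in the
angle** (from the reflection invariance and the exact symmetry `σ_0 = swapSite` of
`(𝕃(π/2), φ_{𝕃(π/2)})`: couple `ω` with `ω''` as in
`finiteQuads_reflection_of_thm21_schrammSmirnov` and put `ω' = swapSite ω''`, so that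
`e^{iα} · S^{π/2}_{ω'} = σ_{α/2} · σ_0 · σ_0 · S^{π/2}_{ω''} = σ_{α/2} · S^{π/2}_{ω''}`).
[cite: DKKMO2020Rotational, Thm. 1.2 (d_SS part) and §7.1 p. 42] -/
theorem finiteQuads_rotation_isoRect_of_thm21_schrammSmirnov (h : DKKMO2020_thm21_schrammSmirnov)
    (hcont : ∀ (Q₀ : Quad (univ : Set ℂ)) (ε : ℝ≥0∞), 0 < ε →
      ∃ Q' Q'' : Quad (univ : Set ℂ), Quad.StrictlyDominated Q' Q₀ ∧ Quad.StrictlyDominated Q₀ Q'' ∧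
        ∃ δ₀ : ℝ, 0 < δ₀ ∧ ∀ δ : ℝ, 0 < δ → δ < δ₀ →
          bondPercolation (zdGraph 2) half
            {ω | (∃ K, Q'.IsCrossing K ∧ K ⊆ openEdgeUnion δ ω) ∧
              ¬ ∃ K, Q''.IsCrossing K ∧ K ⊆ openEdgeUnion δ ω} ≤ ε)
    {ε : ℝ} (hε : 0 < ε) (F : Finset (Quad (univ : Set ℂ))) :
    ∃ δ₀ : ℝ, 0 < δ₀ ∧ ∀ α ∈ Ioo ε (π - ε), ∀ δ : ℝ, 0 < δ → δ ≤ δ₀ →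
      ∃ P : Measure (BondConfig (Site 2) × BondConfig (Site 2)),
        P.map Prod.fst = prodBernoulli (isoRectCriticalProb (π / 2)) ∧
        P.map Prod.snd = prodBernoulli (isoRectCriticalProb (π / 2)) ∧
        P {p | ∃ Q ∈ F, ¬ (Q ∈ isoRectQuadConfig (π / 2) δ p.1 ↔
          Q ∈ QuadConfig.rotate α (isoRectQuadConfig (π / 2) δ p.2))} < ENNReal.ofReal ε := by
  obtain ⟨δ₀, hδ₀, H⟩ := finiteQuads_reflection_of_thm21_schrammSmirnov h hcont hε F
  refine ⟨δ₀, hδ₀, fun α hα δ hδ hδle => ?_⟩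
  obtain ⟨T, hT₁, hT₂, hT⟩ := H α hα δ hδ hδle
  -- `id × swapSite` as a measurable automorphism of pairs of configurations
  let τ : BondConfig (Site 2) ≃ᵐ BondConfig (Site 2) :=
    ⟨Equiv.Set.congr swapPerm, measurable_image_equiv _, measurable_image_equiv _⟩
  let e : BondConfig (Site 2) × BondConfig (Site 2) ≃ᵐ BondConfig (Site 2) × BondConfig (Site 2) :=
    MeasurableEquiv.prodCongr (MeasurableEquiv.refl _) τ
  refine ⟨T.map e, ?_, ?_, ?_⟩
  · rw [Measure.map_map measurable_fst e.measurable]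
    have : Prod.fst ∘ ⇑e = (Prod.fst : BondConfig (Site 2) × BondConfig (Site 2) → _) := rfl
    rw [this, hT₁]
  · rw [Measure.map_map measurable_snd e.measurable]
    have : Prod.snd ∘ ⇑e = (fun ω : BondConfig (Site 2) => swapPerm '' ω) ∘ Prod.snd := rfl
    rw [this, ← Measure.map_map (measurable_image_equiv swapPerm) measurable_snd, hT₂,
      prodBernoulli_isoRectCriticalProb_pi_div_two_map_image_swapPerm]
  · rw [MeasurableEquiv.map_apply]
    refine lt_of_le_of_lt (measure_mono fun p hp => ?_) hT
    obtain ⟨Q, hQF, hQ⟩ : ∃ Q ∈ F, ¬ (Q ∈ isoRectQuadConfig (π / 2) δ p.1 ↔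
        Q ∈ QuadConfig.rotate α (isoRectQuadConfig (π / 2) δ (swapPerm '' p.2))) := hp
    refine ⟨Q, hQF, ?_⟩
    rwa [isoRectQuadConfig_pi_div_two_image_swapPerm, QuadConfig.rotate_eq_mapHomeomorph_lineReflection,
      QuadConfig.mapHomeomorph_lineReflection_mapHomeomorph_lineReflection,
      QuadConfig.mem_mapHomeomorph_lineReflection] at hQ

/-- **Asymptotic rotation invariance of critical bond percolation on `δℤ²` on finitely many quads,
uniformly in the angle** — the hypothesis (F) of
`dkkmo_theorem_1_2_schrammSmirnov_of_finiteQuads_of_continuity` — from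
`DKKMO2020_thm21_schrammSmirnov` and (5.1): `δ𝕃(π/2) = e^{iπ/4}√2 δℤ²`
(`isoRectQuadConfig_pi_div_two_eq_rotate`), rotations commute, and the crossing indicators of the
rotated family `e^{iπ/4} F` in `S^{π/2}` at mesh `δ/√2` are those of `F` in `ω_δ`.
[cite: DKKMO2020Rotational, Thm. 1.2 (d_SS part) and §7.1 p. 42] -/
theorem finiteQuads_rotation_of_thm21_schrammSmirnov (h : DKKMO2020_thm21_schrammSmirnov)
    (hcont : ∀ (Q₀ : Quad (univ : Set ℂ)) (ε : ℝ≥0∞), 0 < ε →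
      ∃ Q' Q'' : Quad (univ : Set ℂ), Quad.StrictlyDominated Q' Q₀ ∧ Quad.StrictlyDominated Q₀ Q'' ∧
        ∃ δ₀ : ℝ, 0 < δ₀ ∧ ∀ δ : ℝ, 0 < δ → δ < δ₀ →
          bondPercolation (zdGraph 2) half
            {ω | (∃ K, Q'.IsCrossing K ∧ K ⊆ openEdgeUnion δ ω) ∧
              ¬ ∃ K, Q''.IsCrossing K ∧ K ⊆ openEdgeUnion δ ω} ≤ ε)
    {ε : ℝ} (hε : 0 < ε) (F : Finset (Quad (univ : Set ℂ))) :
    ∃ δ₀ : ℝ, 0 < δ₀ ∧ ∀ α ∈ Ioo ε (π - ε), ∀ δ : ℝ, 0 < δ → δ ≤ δ₀ →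
      ∃ P : Measure (BondConfig (Site 2) × BondConfig (Site 2)),
        P.map Prod.fst = bondPercolation (zdGraph 2) half ∧
        P.map Prod.snd = bondPercolation (zdGraph 2) half ∧
        P {p | ∃ Q ∈ F, ¬ (Q ∈ z2QuadConfig univ δ p.1 ↔
          Q ∈ QuadConfig.rotate α (z2QuadConfig univ δ p.2))} < ENNReal.ofReal ε := by
  classical
  set ρ : ℂ ≃ₜ ℂ := (rotation (Circle.exp (π / 4))).toHomeomorph with hρ
  obtain ⟨δ₀, hδ₀, H⟩ := finiteQuads_rotation_isoRect_of_thm21_schrammSmirnov h hcont hε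
    (F.image fun Q => Q.mapHomeomorph ρ)
  have h2 : 0 < Real.sqrt 2 := Real.sqrt_pos.2 two_pos
  have h2' : (1 : ℝ) ≤ Real.sqrt 2 := Real.one_le_sqrt.2 (by norm_num)
  refine ⟨δ₀, hδ₀, fun α hα δ hδ hδle => ?_⟩
  have hδ' : 0 < δ / Real.sqrt 2 := div_pos hδ h2
  have hδ'le : δ / Real.sqrt 2 ≤ δ₀ := (div_le_self hδ.le h2').trans hδle
  obtain ⟨P, hP₁, hP₂, hP⟩ := H α hα (δ / Real.sqrt 2) hδ' hδ'le
  rw [prodBernoulli_isoRectCriticalProb_pi_div_two] at hP₁ hP₂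
  refine ⟨P, hP₁, hP₂, lt_of_le_of_lt (measure_mono fun p hp => ?_) hP⟩
  obtain ⟨Q, hQF, hQ⟩ := hp
  refine ⟨Q.mapHomeomorph ρ, Finset.mem_image_of_mem _ hQF, ?_⟩
  have hmesh : Real.sqrt 2 * (δ / Real.sqrt 2) = δ := mul_div_cancel₀ δ h2.ne'
  have hmem : ∀ X : QuadConfig (univ : Set ℂ),
      Q.mapHomeomorph ρ ∈ QuadConfig.rotate (π / 4) X ↔ Q ∈ X := fun X => by
    show Q.mapHomeomorph ρ ∈ X.mapHomeomorph ρ ↔ Q ∈ X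
    rw [QuadConfig.mem_mapHomeomorph, Quad.mapHomeomorph_symm_mapHomeomorph]
  rwa [isoRectQuadConfig_pi_div_two_eq_rotate, isoRectQuadConfig_pi_div_two_eq_rotate, hmesh,
    QuadConfig.rotate_rotate, add_comm, ← QuadConfig.rotate_rotate, hmem, hmem]

/-! ### Theorem 1.2 (`d_SS` half) from Theorem 2.1 (`d_SS` half) -/

/-- **DKKMO Theorem 1.2 (`d_SS` part, `q = 1`, `Ω = ℝ²`) from Theorem 2.1 (`d_SS` part, `q = 1`)
and Schramm–Smirnov's (5.1)** (the hypothesis of `SchrammSmirnov2011_lemma_5_1_of_continuity`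
at `D = univ`): the printed reflection argument (§7.1 p. 42, Case of `Ω = ℝ²`) on finitely many
quads (`finiteQuads_rotation_of_thm21_schrammSmirnov`), then the reduction of the metric-free
`d_SS` statement to finitely many quads
(`dkkmo_theorem_1_2_schrammSmirnov_of_finiteQuads_of_continuity`).
[cite: DKKMO2020Rotational, Thm. 1.2 (d_SS part) and §7.1 p. 42] -/
theorem dkkmo_theorem_1_2_schrammSmirnov_of_thm21_schrammSmirnov_of_continuity
    (h : DKKMO2020_thm21_schrammSmirnov)
    (hcont : ∀ (Q₀ : Quad (univ : Set ℂ)) (ε : ℝ≥0∞), 0 < ε →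
      ∃ Q' Q'' : Quad (univ : Set ℂ), Quad.StrictlyDominated Q' Q₀ ∧ Quad.StrictlyDominated Q₀ Q'' ∧
        ∃ δ₀ : ℝ, 0 < δ₀ ∧ ∀ δ : ℝ, 0 < δ → δ < δ₀ →
          bondPercolation (zdGraph 2) half
            {ω | (∃ K, Q'.IsCrossing K ∧ K ⊆ openEdgeUnion δ ω) ∧
              ¬ ∃ K, Q''.IsCrossing K ∧ K ⊆ openEdgeUnion δ ω} ≤ ε) :
    dkkmo_theorem_1_2_schrammSmirnov :=
  dkkmo_theorem_1_2_schrammSmirnov_of_finiteQuads_of_continuity hcont fun _ hε F =>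
    finiteQuads_rotation_of_thm21_schrammSmirnov h hcont hε F

/-- **DKKMO Theorem 1.2 (`d_SS` part, `q = 1`, `Ω = ℝ²`) follows from Theorem 2.1 (`d_SS` part,
`q = 1`)** — the vendored fact `dkkmo_theorem_1_2_schrammSmirnov` is a corollary of the vendored
fact `DKKMO2020_thm21_schrammSmirnov`, by the printed proof of Theorem 1.2 for `Ω = ℝ²` (§7.1
p. 42: "`d_SS(ω, e^{iα}ω') = d_SS(σ_{α/2}ω, σ_0ω') ≤ d_SS(σ_{α/2}ω, ω^α) + d_SS(ω^α, σ_0ω')`"),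
Schramm–Smirnov's Lemma 5.1 being discharged in the tree (`SchrammSmirnov2011_lemma_5_1_holds`).
[cite: DKKMO2020Rotational, Thm. 1.2 (d_SS part) and §7.1 p. 42] -/
theorem dkkmo_theorem_1_2_schrammSmirnov_of_thm21_schrammSmirnov
    (h : DKKMO2020_thm21_schrammSmirnov) : dkkmo_theorem_1_2_schrammSmirnov :=
  dkkmo_theorem_1_2_schrammSmirnov_of_thm21_schrammSmirnov_of_continuity h
    fun Q₀ ε hε => Quad.continuity_of_lemma_5_1 SchrammSmirnov2011_lemma_5_1_holds Q₀ ε hε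

end Literature.Probability.Percolation
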